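import Mathlib.CategoryTheory.Filtered.Final
import Mathlib.CategoryTheory.Functor.OfSequence
import Mathlib.CategoryTheory.Conj
import Literature.AlgebraicGeometry.Frobenioids.PadicFrobenioidBaseGaloisSystem
import HarnessLib

/-!
# Base-point independence of the Galois pro-system of `B^temp(Π)⁰` (GAP-LEDGER G-w5d188-1 (b))

Mochizuki, *The geometry of Frobenioids II*, Kyushu J. Math. **62** (2008), §2, proof of Theorem 2.4 (ii),
p. 20 l.−5 – p. 21 l. 6 [cite: MochizukiFrdII2008, Thm 2.4 (ii) p.20]: the pair `(G, K̄^×)` reconstructed "by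
varying the objects `Aᵢ`" of a universal covering is "well-defined up to … automorphisms of the pair induced
by elements of `G`".  PROOF-ONLY companion of `PadicFrobenioidBaseGaloisSystem` ((a): the system
`galoisSystem hG N hN`, `Π ≃* Aut`), supplying part (b) of GAP row G-w5d188-1 (cell abc-iut): the choice of
the universal covering does not matter.

* §1 `bigSystem hG : (OpenNormalSubgroup Π)ᵒᵈ ⥤ (B^temp(Π)⁰)ᵒᵖ` — ALL the `Π/M`, and `galoisSystem hG N hN ≅
  seqIndex N hN ⋙ bigSystem hG`; a cofinal sequence gives a FINAL functor `seqIndex N hN` (Mathlib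
  `Functor.final_of_exists_of_isFiltered`), so direct limits along the sequence are canonically those along
  the big system (`Functor.Final.colimitIso`), compatibly with the `Π`-actions (`toAut`, `toAutBig`):
  `exists_colimit_iso_equivariant` — for two cofinal sequences `N`, `N'` and any `F`, an isomorphism
  `lim→ F(Π/N_k) ≅ lim→ F(Π/N'_k)` intertwining `toAut N g` and `toAut N' g` for every `g ∈ Π` (choice-free).
* §2 STRAIGHTENING: any functor `c : ℕ ⥤ (B^temp(Π)⁰)ᵒᵖ` whose terms are Galois objects and which is cofinal
  (`∀ X, ∃ k, Nonempty (c_k ⟶ X)`) is isomorphic to `galoisSystem hG N hN` for some cofinal antitone `N`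
  (`exists_iso_galoisSystem`; the isomorphisms are chosen inductively along the sequence, which is where the
  "up to elements of `G`" enters); hence `Aut c ≃* Π` (`exists_mulEquiv_aut`) and direct limits along `c` are
  those along `galoisSystem`, equivariantly along `Iso.conjAut` (`exists_colimit_iso_equivariant_of_galois_cofinal`).

Classical Galois-category bookkeeping ([SemiAnbd] Rmk 3.2.1 p. 35 "well-defined, up to inner automorphism";
SGA 1 V §4–5); theorems and auxiliary constructions only, no `Prop`-valued definition; nothing here bears on
[IUTchIII] Cor. 3.12.
-/

noncomputable section

namespace Literature.AlgebraicGeometry.Frobenioids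

open CategoryTheory CategoryTheory.Limits Opposite Topology Filter
open Literature.AnabelianGeometry.SemiGraphs
open Literature.AlgebraicGeometry.Frobenioids.QuasiTemperoid.BTempConnected

universe v₃ u₃ u

namespace BaseGaloisSystem

variable {G : Type u} [Group G] [TopologicalSpace G] [IsTopologicalGroup G] (hG : IsTempered G)

/-! ### §1 The big system over all open normal subgroups -/

/-- ALL the quotient objects `Π/M`, `M` open normal, indexed by `(OpenNormalSubgroup Π)ᵒᵈ` (so that arrows
point towards SMALLER subgroups), with the projections as transition maps: a functor to `(B^temp(Π)⁰)ᵒᵖ`.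
[cite: MochizukiSemiAnbd2006, Rmk 3.1.2 p.33] -/
def bigSystem : (OpenNormalSubgroup G)ᵒᵈ ⥤ (ConnectedPart (BTemp G))ᵒᵖ where
  obj M := op (QC hG (OrderDual.ofDual M))
  map {M M'} f := (projC hG (show OrderDual.ofDual M' ≤ OrderDual.ofDual M from f.le)).op
  map_id M := by
    change (projC hG _).op = 𝟙 (op (QC hG (OrderDual.ofDual M)))
    rw [projC_self, op_id]
  map_comp {M M' M''} f g := by
    change (projC hG _).op = (projC hG _).op ≫ (projC hG _).op
    rw [← op_comp, projC_comp]

/-- Terms of the big system. [cite: MochizukiSemiAnbd2006, Rmk 3.1.2 p.33] -/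
@[simp] theorem bigSystem_obj (M : (OpenNormalSubgroup G)ᵒᵈ) :
    (bigSystem hG).obj M = op (QC hG (OrderDual.ofDual M)) := rfl

variable (N : ℕ → OpenNormalSubgroup G) (hN : Antitone N)

omit [IsTopologicalGroup G] in
/-- The index functor `k ↦ N_k` of an antitone sequence. [folklore] -/
def seqIndex : ℕ ⥤ (OpenNormalSubgroup G)ᵒᵈ :=
  (Antitone.dual_right hN).functor

omit [IsTopologicalGroup G] in
/-- Terms of the index functor. [cite: MochizukiSemiAnbd2006, Rmk 3.1.2 p.33] -/
@[simp] theorem seqIndex_obj (k : ℕ) : (seqIndex N hN).obj k = OrderDual.toDual (N k) := rfl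

omit [IsTopologicalGroup G] in
/-- A COFINAL antitone sequence of open normal subgroups indexes a FINAL functor into `(OpenNormalSubgroup Π)ᵒᵈ`
("universal covering … by varying the objects `Aᵢ`"). [cite: MochizukiFrdII2008, Thm 2.4 (ii) p.21] -/
theorem seqIndex_final (hNb : ∀ U ∈ 𝓝 (1 : G), ∃ k, (N k : Set G) ⊆ U) : (seqIndex N hN).Final := by
  refine Functor.final_of_exists_of_isFiltered _ (fun M => ?_) (fun {_ c} _ _ => ⟨c, 𝟙 _, Subsingleton.elim _ _⟩)
  obtain ⟨k, hk⟩ := hNb _ (OrderDual.ofDual M).toOpenSubgroup.mem_nhds_one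
  have hk' : N k ≤ OrderDual.ofDual M := fun x hx => hk hx
  exact ⟨k, ⟨homOfLE (show M ≤ (seqIndex N hN).obj k from hk')⟩⟩

/-- The sequence system IS the big system restricted along `seqIndex` (componentwise identities). [cite: MochizukiFrdII2008, Thm 2.4 (ii) p.21] -/
def galoisSystemIsoComp : galoisSystem hG N hN ≅ seqIndex N hN ⋙ bigSystem hG :=
  Iso.refl (galoisSystem hG N hN)

/-- Indeed the two functors are EQUAL (definitionally). [cite: MochizukiFrdII2008, Thm 2.4 (ii) p.21] -/
theorem galoisSystem_eq_comp : galoisSystem hG N hN = seqIndex N hN ⋙ bigSystem hG := rfl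

/-- Components of `galoisSystemIsoComp`. [cite: MochizukiFrdII2008, Thm 2.4 (ii) p.21] -/
@[simp] theorem galoisSystemIsoComp_hom_app (k : ℕ) :
    (galoisSystemIsoComp hG N hN).hom.app k = 𝟙 _ := rfl

/-- Components of `galoisSystemIsoComp⁻¹`. [cite: MochizukiFrdII2008, Thm 2.4 (ii) p.21] -/
@[simp] theorem galoisSystemIsoComp_inv_app (k : ℕ) :
    (galoisSystemIsoComp hG N hN).inv.app k = 𝟙 _ := rfl

/-- The `Π`-action on the big system: right translation by `g` on every `Π/M`. [cite: MochizukiFrdII2008, Thm 2.4 (ii) p.21] -/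
def toAutBig : G →* Aut (bigSystem hG) where
  toFun g := NatIso.ofComponents
    (fun M => (ObjectProperty.isoMk (C := BTemp G) (P := connectedObjects (BTemp G))
      { hom := BTemp.rightMul hG (OrderDual.ofDual M) g
        inv := BTemp.rightMul hG (OrderDual.ofDual M) g⁻¹
        hom_inv_id := by
          change BTemp.rightMul hG _ g ≫ BTemp.rightMul hG _ g⁻¹ = 𝟙 (BTemp.Q hG (OrderDual.ofDual M))
          rw [BTemp.rightMul_comp, mul_inv_cancel, BTemp.rightMul_one]
        inv_hom_id := by
          change BTemp.rightMul hG _ g⁻¹ ≫ BTemp.rightMul hG _ g = 𝟙 (BTemp.Q hG (OrderDual.ofDual M))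
          rw [BTemp.rightMul_comp, inv_mul_cancel, BTemp.rightMul_one] }).op)
    (fun {M M'} f => by
      change (projC hG _).op ≫ (rightMulC hG _ g).op = (rightMulC hG _ g).op ≫ (projC hG _).op
      rw [← op_comp, ← op_comp, rightMulC_projC])
  map_one' := by
    apply Iso.ext
    ext M
    change (rightMulC hG (OrderDual.ofDual M) 1).op = 𝟙 (op (QC hG (OrderDual.ofDual M)))
    rw [rightMulC_one, op_id]
  map_mul' a b := by
    apply Iso.ext
    ext M
    change (rightMulC hG _ (a * b)).op = (rightMulC hG _ b).op ≫ (rightMulC hG _ a).op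
    rw [← op_comp, rightMulC_comp]

/-- Components of `toAutBig g`: right translation by `g`. [cite: MochizukiFrdII2008, Thm 2.4 (ii) p.21] -/
@[simp] theorem toAutBig_hom_app (g : G) (M : (OpenNormalSubgroup G)ᵒᵈ) :
    (toAutBig hG g).hom.app M = (rightMulC hG (OrderDual.ofDual M) g).op := rfl

/-- The actions on the sequence and on the big system agree along `seqIndex`. [cite: MochizukiFrdII2008, Thm 2.4 (ii) p.21] -/
theorem toAut_hom_app_eq (g : G) (k : ℕ) :
    (toAut hG N hN g).hom.app k = (toAutBig hG g).hom.app ((seqIndex N hN).obj k) := rfl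

section Colimits

variable {C : Type u₃} [Category.{v₃} C] (F : (ConnectedPart (BTemp G))ᵒᵖ ⥤ C)

/-- **Direct limits along a cofinal sequence are direct limits along the big system**, equivariantly for the
`Π`-actions: the canonical isomorphism (Mathlib `Functor.Final.colimitIso`) intertwines `toAut N g` and
`toAutBig g`. [cite: MochizukiFrdII2008, Thm 2.4 (ii) p.21] -/
theorem exists_colimit_iso_big_equivariant (hNb : ∀ U ∈ 𝓝 (1 : G), ∃ k, (N k : Set G) ⊆ U)
    [HasColimit (galoisSystem hG N hN ⋙ F)] [HasColimit (bigSystem hG ⋙ F)] :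
    ∃ e : colimit (galoisSystem hG N hN ⋙ F) ≅ colimit (bigSystem hG ⋙ F),
      ∀ g : G, e.hom ≫ colimMap (Functor.whiskerRight (toAutBig hG g).hom F) =
        colimMap (Functor.whiskerRight (toAut hG N hN g).hom F) ≫ e.hom := by
  haveI := seqIndex_final N hN hNb
  -- `galoisSystem ⋙ F` is definitionally `seqIndex ⋙ (bigSystem ⋙ F)` and `HasColimit` is a `Prop`, so the
  -- canonical `Functor.Final.colimitIso` has the required type
  let e : colimit (galoisSystem hG N hN ⋙ F) ≅ colimit (bigSystem hG ⋙ F) :=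
    Functor.Final.colimitIso (seqIndex N hN) (bigSystem hG ⋙ F)
  have hι : ∀ k, colimit.ι (galoisSystem hG N hN ⋙ F) k ≫ e.hom =
      colimit.ι (bigSystem hG ⋙ F) ((seqIndex N hN).obj k) :=
    fun k => Functor.Final.ι_colimitIso_hom (seqIndex N hN) (bigSystem hG ⋙ F) k
  refine ⟨e, fun g => ?_⟩
  apply colimit.hom_ext
  intro k
  have hL : colimit.ι (galoisSystem hG N hN ⋙ F) k ≫ e.hom ≫
      colimMap (Functor.whiskerRight (toAutBig hG g).hom F) =
        F.map ((toAutBig hG g).hom.app ((seqIndex N hN).obj k)) ≫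
          colimit.ι (bigSystem hG ⋙ F) ((seqIndex N hN).obj k) := by
    rw [reassoc_of% (hι k)]
    exact ι_colimMap (Functor.whiskerRight (toAutBig hG g).hom F) ((seqIndex N hN).obj k)
  have hR : colimit.ι (galoisSystem hG N hN ⋙ F) k ≫
      colimMap (Functor.whiskerRight (toAut hG N hN g).hom F) ≫ e.hom =
        F.map ((toAut hG N hN g).hom.app k) ≫ colimit.ι (bigSystem hG ⋙ F) ((seqIndex N hN).obj k) := by
    rw [ι_colimMap_assoc, hι k, Functor.whiskerRight_app]
    rfl
  rw [hL, hR, toAut_hom_app_eq]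
  rfl

/-- **Base-point independence, choice-free form (G-w5d188-1 (b), two universal coverings of the standard
shape).**  For two cofinal antitone sequences `N`, `N'` of open normal subgroups and any functor `F` out of
`(B^temp(Π)⁰)ᵒᵖ` there is an isomorphism of direct limits `lim→_k F(Π/N_k) ≅ lim→_k F(Π/N'_k)` intertwining,
for EVERY `g ∈ Π`, the action of `g` on the two sides (`toAut N g`, `toAut N' g`); equivalently, along the
group isomorphism `θ = (toAutMulEquiv N') ∘ (toAutMulEquiv N)⁻¹ : Aut (galoisSystem N) ≃* Aut (galoisSystem N')`.
[cite: MochizukiFrdII2008, Thm 2.4 (ii) p.21] -/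
theorem exists_colimit_iso_equivariant (N' : ℕ → OpenNormalSubgroup G) (hN' : Antitone N')
    (hNb : ∀ U ∈ 𝓝 (1 : G), ∃ k, (N k : Set G) ⊆ U) (hN'b : ∀ U ∈ 𝓝 (1 : G), ∃ k, (N' k : Set G) ⊆ U)
    [HasColimit (galoisSystem hG N hN ⋙ F)] [HasColimit (galoisSystem hG N' hN' ⋙ F)]
    [HasColimit (bigSystem hG ⋙ F)] :
    ∃ e : colimit (galoisSystem hG N hN ⋙ F) ≅ colimit (galoisSystem hG N' hN' ⋙ F),
      ∀ g : G, e.hom ≫ colimMap (Functor.whiskerRight (toAut hG N' hN' g).hom F) =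
        colimMap (Functor.whiskerRight (toAut hG N hN g).hom F) ≫ e.hom := by
  obtain ⟨e₁, he₁⟩ := exists_colimit_iso_big_equivariant hG N hN F hNb
  obtain ⟨e₂, he₂⟩ := exists_colimit_iso_big_equivariant hG N' hN' F hN'b
  refine ⟨e₁ ≪≫ e₂.symm, fun g => ?_⟩
  have h₂ : e₂.inv ≫ colimMap (Functor.whiskerRight (toAut hG N' hN' g).hom F) =
      colimMap (Functor.whiskerRight (toAutBig hG g).hom F) ≫ e₂.inv := by
    rw [Iso.inv_comp_eq, ← Category.assoc, he₂ g, Category.assoc, Iso.hom_inv_id, Category.comp_id]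
  simp only [Iso.trans_hom, Iso.symm_hom, Category.assoc]
  rw [h₂, reassoc_of% (he₁ g)]

/-- The same equivariance, phrased along the group isomorphism
`θ := (toAutMulEquiv N').toMonoidHom ∘ (toAutMulEquiv N).symm : Aut (galoisSystem N) ≃* Aut (galoisSystem N')`
as in the GAP-LEDGER row: `e.hom ≫ colimMap ((θ σ).hom ▷ F) = colimMap (σ.hom ▷ F) ≫ e.hom` for every
`σ ∈ Aut (galoisSystem N)`. [cite: MochizukiFrdII2008, Thm 2.4 (ii) p.21] -/
theorem exists_colimit_iso_equivariant_aut (N' : ℕ → OpenNormalSubgroup G) (hN' : Antitone N')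
    (hNb : ∀ U ∈ 𝓝 (1 : G), ∃ k, (N k : Set G) ⊆ U) (hN'b : ∀ U ∈ 𝓝 (1 : G), ∃ k, (N' k : Set G) ⊆ U)
    [HasColimit (galoisSystem hG N hN ⋙ F)] [HasColimit (galoisSystem hG N' hN' ⋙ F)]
    [HasColimit (bigSystem hG ⋙ F)] :
    ∃ e : colimit (galoisSystem hG N hN ⋙ F) ≅ colimit (galoisSystem hG N' hN' ⋙ F),
      ∀ σ : Aut (galoisSystem hG N hN),
        e.hom ≫ colimMap (Functor.whiskerRight
          (((toAutMulEquiv hG N hN hNb).symm.trans (toAutMulEquiv hG N' hN' hN'b)) σ).hom F) =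
        colimMap (Functor.whiskerRight σ.hom F) ≫ e.hom := by
  obtain ⟨e, he⟩ := exists_colimit_iso_equivariant hG N hN F N' hN' hNb hN'b
  refine ⟨e, fun σ => ?_⟩
  obtain ⟨g, rfl⟩ := (toAutMulEquiv hG N hN hNb).surjective σ
  rw [MulEquiv.trans_apply, MulEquiv.symm_apply_apply, toAutMulEquiv_apply, toAutMulEquiv_apply]
  exact he g

end Colimits

/-! ### §2 Straightening an arbitrary Galois cofinal sequence -/

/-- **Structure of maps between quotient objects**: a `B^temp`-morphism `f : Π/N₁ → Π/N₂` (`Nᵢ` open normal)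
with `f(N₁) = a N₂` forces `N₁ ≤ N₂` and is `xN₁ ↦ x a N₂`, i.e. `f = r_a ≫ proj`. [cite: MochizukiSemiAnbd2006, Rmk 3.1.3 p.34] -/
theorem hom_Q_eq {N₁ N₂ : OpenNormalSubgroup G} (f : BTemp.Q hG N₁ ⟶ BTemp.Q hG N₂) (a : G)
    (ha : f.hom.hom ((1 : G) : G ⧸ N₁.toSubgroup) = (a : G ⧸ N₂.toSubgroup)) :
    ∃ h : N₁ ≤ N₂, f = BTemp.rightMul hG N₁ a ≫ BTemp.proj hG h := by
  have hact : ∀ x : G, f.hom.hom (x : G ⧸ N₁.toSubgroup) = ((x * a : G) : G ⧸ N₂.toSubgroup) := by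
    intro x
    have h := hom_ρ f x ((1 : G) : G ⧸ N₁.toSubgroup)
    rw [BTemp.Q_ρ_apply, mul_one] at h
    rw [h, ha, BTemp.Q_ρ_apply]
  have hle : N₁ ≤ N₂ := by
    intro n hn
    have h1 : ((n : G) : G ⧸ N₁.toSubgroup) = ((1 : G) : G ⧸ N₁.toSubgroup) := by
      rw [QuotientGroup.eq, mul_one]
      exact inv_mem hn
    have h2 := hact n
    rw [h1, hact 1, one_mul] at h2
    -- `a N₂ = n a N₂`, so `a⁻¹ n a ∈ N₂`, so `n ∈ N₂` by normality
    have h3 : a⁻¹ * (n * a) ∈ N₂.toSubgroup := QuotientGroup.eq.mp h2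
    have h4 : a * (a⁻¹ * (n * a)) * a⁻¹ ∈ N₂.toSubgroup := N₂.isNormal'.conj_mem _ h3 a
    have h5 : n ∈ N₂.toSubgroup := by simpa [mul_assoc] using h4
    exact h5
  refine ⟨hle, hom_ext_apply fun q => ?_⟩
  obtain ⟨x, rfl⟩ := QuotientGroup.mk_surjective q
  change f.hom.hom (x : G ⧸ N₁.toSubgroup) =
    (BTemp.proj hG hle).hom.hom ((BTemp.rightMul hG N₁ a).hom.hom (x : G ⧸ N₁.toSubgroup))
  rw [hact, BTemp.rightMul_apply, BTemp.proj_apply]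

/-- The right-translation isomorphism of `QC hG N` by `a`. [folklore] -/
def rightMulIsoC (N : OpenNormalSubgroup G) (a : G) : QC hG N ≅ QC hG N where
  hom := rightMulC hG N a
  inv := rightMulC hG N a⁻¹
  hom_inv_id := by rw [rightMulC_comp, mul_inv_cancel, rightMulC_one]
  inv_hom_id := by rw [rightMulC_comp, inv_mul_cancel, rightMulC_one]

/-- `rightMulIsoC` has `rightMulC` as its `hom`. [cite: MochizukiSemiAnbd2006, Rmk 3.1.2 p.33] -/
@[simp] theorem rightMulIsoC_hom (N : OpenNormalSubgroup G) (a : G) :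
    (rightMulIsoC hG N a).hom = rightMulC hG N a := rfl

include hG in
/-- **Straightening (G-w5d188-1 (b), arbitrary universal covering).**  Every functor `c : ℕ ⥤ (B^temp(Π)⁰)ᵒᵖ`
whose terms are Galois objects of `B^temp(Π)` and which is cofinal (every object receives a morphism from some
term) is isomorphic to the standard system `galoisSystem hG N hN` along some cofinal antitone sequence `N` of
open normal subgroups.  (The isomorphisms are chosen inductively along the sequence; different choices differ by
the `Π`-action — the printed "well-defined up to … elements of `G`".) [cite: MochizukiFrdII2008, Thm 2.4 (ii) p.21] -/
theorem exists_iso_galoisSystem (c : ℕ ⥤ (ConnectedPart (BTemp G))ᵒᵖ)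
    (hgal : ∀ k, IsGaloisObj (c.obj k).unop.obj)
    (hcof : ∀ X : ConnectedPart (BTemp G), ∃ k, Nonempty ((c.obj k).unop ⟶ X)) :
    ∃ (N : ℕ → OpenNormalSubgroup G) (hN : Antitone N),
      (∀ U ∈ 𝓝 (1 : G), ∃ k, (N k : Set G) ⊆ U) ∧ Nonempty (c ≅ galoisSystem hG N hN) := by
  classical
  -- each term is `≅ Π/N_k` for an open normal `N_k`
  have hq : ∀ k, ∃ N : OpenNormalSubgroup G,
      Nonempty ((c.obj k).unop.obj ≅ BTemp.quotientObj G hG N.toSubgroup N.isOpen') :=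
    fun k => GaloisObjects.exists_iso_quotientObj_of_isGaloisObj hG _ (hgal k)
  choose N hNe using hq
  let e : ∀ k, (c.obj k).unop ≅ QC hG (N k) := fun k =>
    ObjectProperty.isoMk (C := BTemp G) (P := connectedObjects (BTemp G)) (hNe k).some
  -- the transition maps, unop'd
  let t : ∀ k, (c.obj (k + 1)).unop ⟶ (c.obj k).unop := fun k => (c.map (homOfLE (Nat.le_succ k))).unop
  -- representatives of the values at the base point of the transported maps, level by level:
  -- straightened isomorphisms `φ_k : c_k ≅ Π/N_k` with `φ_{k+1} ≫ proj = t_k ≫ φ_k`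
  have hrep : ∀ (k : ℕ) (φk : (c.obj k).unop ≅ QC hG (N k)), ∃ a : G,
      ((e (k + 1)).inv ≫ t k ≫ φk.hom).hom.hom.hom ((1 : G) : G ⧸ (N (k + 1)).toSubgroup) =
        (a : G ⧸ (N k).toSubgroup) := fun k φk => by
    obtain ⟨a, ha⟩ := QuotientGroup.mk_surjective
      (((e (k + 1)).inv ≫ t k ≫ φk.hom).hom.hom.hom ((1 : G) : G ⧸ (N (k + 1)).toSubgroup))
    exact ⟨a, ha.symm⟩
  let φ : ∀ k, (c.obj k).unop ≅ QC hG (N k) := fun k =>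
    Nat.rec (motive := fun k => (c.obj k).unop ≅ QC hG (N k)) (e 0)
      (fun k φk => e (k + 1) ≪≫ rightMulIsoC hG (N (k + 1)) (Classical.choose (hrep k φk))) k
  have hφ_succ : ∀ k, φ (k + 1) = e (k + 1) ≪≫ rightMulIsoC hG (N (k + 1)) (Classical.choose (hrep k (φ k))) :=
    fun k => rfl
  -- the key computation at each level
  have hstep : ∀ k, ∃ h : N (k + 1) ≤ N k, (φ (k + 1)).hom ≫ projC hG h = t k ≫ (φ k).hom := by
    intro k
    obtain ⟨h, hf⟩ := hom_Q_eq hG ((e (k + 1)).inv ≫ t k ≫ (φ k).hom).hom _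
      (Classical.choose_spec (hrep k (φ k)))
    refine ⟨h, ?_⟩
    have hf' : (e (k + 1)).inv ≫ t k ≫ (φ k).hom =
        rightMulC hG (N (k + 1)) (Classical.choose (hrep k (φ k))) ≫ projC hG h :=
      ObjectProperty.hom_ext _ hf
    rw [hφ_succ, Iso.trans_hom, rightMulIsoC_hom, Category.assoc, ← hf', Iso.hom_inv_id_assoc]
  have hanti : Antitone N := antitone_nat_of_succ_le fun k => (hstep k).1
  -- cofinality of `N`
  have hNb : ∀ U ∈ 𝓝 (1 : G), ∃ k, (N k : Set G) ⊆ U := by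
    intro U hU
    obtain ⟨M, -, hMU⟩ := hG.basis U hU
    obtain ⟨k, ⟨f⟩⟩ := hcof (QC hG M)
    obtain ⟨a, ha⟩ := QuotientGroup.mk_surjective
      (((φ k).inv ≫ f).hom.hom.hom ((1 : G) : G ⧸ (N k).toSubgroup))
    obtain ⟨h, -⟩ := hom_Q_eq hG ((φ k).inv ≫ f).hom a ha.symm
    exact ⟨k, fun x hx => hMU (h hx)⟩
  refine ⟨N, hanti, hNb, ⟨?_⟩⟩
  -- the natural isomorphism, built from successor naturality
  let η : c ⟶ galoisSystem hG N hanti :=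
    NatTrans.ofSequence (fun k => ((φ k).inv).op) (fun k => by
      obtain ⟨h, hk⟩ := hstep k
      have hk' : projC hG (hanti (Nat.le_succ k)) ≫ (φ k).inv = (φ (k + 1)).inv ≫ t k := by
        rw [show projC hG (hanti (Nat.le_succ k)) = projC hG h from rfl, Iso.comp_inv_eq, Category.assoc,
          ← hk, Iso.inv_hom_id_assoc]
      have ht : c.map (homOfLE (Nat.le_succ k)) = (t k).op := rfl
      rw [galoisSystem_map, ht]
      apply Quiver.Hom.unop_inj
      change (φ (k + 1)).inv ≫ t k = projC hG (hanti (Nat.le_succ k)) ≫ (φ k).inv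
      exact hk'.symm)
  haveI : ∀ k, IsIso (η.app k) := fun k => by
    change IsIso ((φ k).inv).op
    infer_instance
  haveI : IsIso η := NatIso.isIso_of_isIso_app η
  exact asIso η

include hG in
/-- **`Aut c ≃* Π` for an arbitrary Galois cofinal system** (conjugate the identification of (a) along a
straightening isomorphism; canonical up to inner automorphisms of `Π`). [cite: MochizukiSemiAnbd2006, Rmk 3.2.1 p.35] -/
theorem exists_mulEquiv_aut (c : ℕ ⥤ (ConnectedPart (BTemp G))ᵒᵖ)
    (hgal : ∀ k, IsGaloisObj (c.obj k).unop.obj)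
    (hcof : ∀ X : ConnectedPart (BTemp G), ∃ k, Nonempty ((c.obj k).unop ⟶ X)) :
    Nonempty (Aut c ≃* G) := by
  obtain ⟨N, hN, hNb, ⟨ι⟩⟩ := exists_iso_galoisSystem hG c hgal hcof
  exact ⟨ι.conjAut.trans (toAutMulEquiv hG N hN hNb).symm⟩

section Colimits

variable {C : Type u₃} [Category.{v₃} C] (F : (ConnectedPart (BTemp G))ᵒᵖ ⥤ C)

omit [IsTopologicalGroup G] in
/-- Transport of direct limits along an isomorphism of systems is equivariant for `Iso.conjAut` (the formal
part of "well-defined up to … automorphisms of the pair"). [cite: MochizukiFrdII2008, Thm 2.4 (ii) p.21] -/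
theorem colimit_isoOfNatIso_conjAut {J : Type*} [Category J] {c c' : J ⥤ (ConnectedPart (BTemp G))ᵒᵖ}
    (ι : c ≅ c') [HasColimit (c ⋙ F)] [HasColimit (c' ⋙ F)] (σ : Aut c) :
    (HasColimit.isoOfNatIso (Functor.isoWhiskerRight ι F)).hom ≫
        colimMap (Functor.whiskerRight (ι.conjAut σ).hom F) =
      colimMap (Functor.whiskerRight σ.hom F) ≫ (HasColimit.isoOfNatIso (Functor.isoWhiskerRight ι F)).hom := by
  have key : (Functor.isoWhiskerRight ι F).hom ≫ Functor.whiskerRight (ι.conjAut σ).hom F =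
      Functor.whiskerRight σ.hom F ≫ (Functor.isoWhiskerRight ι F).hom := by
    rw [Functor.isoWhiskerRight_hom, Iso.conjAut_hom, Iso.conj_apply, ← Functor.whiskerRight_comp,
      ← Functor.whiskerRight_comp, Iso.hom_inv_id_assoc]
  apply colimit.hom_ext
  intro j
  rw [HasColimit.isoOfNatIso_ι_hom_assoc, ι_colimMap, ι_colimMap_assoc, HasColimit.isoOfNatIso_ι_hom,
    ← NatTrans.comp_app_assoc, ← NatTrans.comp_app_assoc, key]

include hG in
/-- **Base-point independence for an arbitrary universal covering (G-w5d188-1 (b)).**  For a Galois cofinal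
system `c` and any `F`, the direct limit along `c` is isomorphic to the one along a standard system
`galoisSystem hG N hN`, equivariantly along a group isomorphism `θ : Aut c ≃* Aut (galoisSystem hG N hN)`
(`= Iso.conjAut` of a straightening isomorphism). [cite: MochizukiFrdII2008, Thm 2.4 (ii) p.21] -/
theorem exists_colimit_iso_equivariant_of_galois_cofinal (c : ℕ ⥤ (ConnectedPart (BTemp G))ᵒᵖ)
    (hgal : ∀ k, IsGaloisObj (c.obj k).unop.obj)
    (hcof : ∀ X : ConnectedPart (BTemp G), ∃ k, Nonempty ((c.obj k).unop ⟶ X)) [HasColimit (c ⋙ F)]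
    (hF : ∀ (N : ℕ → OpenNormalSubgroup G) (hN : Antitone N), HasColimit (galoisSystem hG N hN ⋙ F)) :
    ∃ (N : ℕ → OpenNormalSubgroup G) (hN : Antitone N) (_ : ∀ U ∈ 𝓝 (1 : G), ∃ k, (N k : Set G) ⊆ U)
      (θ : Aut c ≃* Aut (galoisSystem hG N hN))
      (e : colimit (c ⋙ F) ≅ @colimit _ _ _ _ (galoisSystem hG N hN ⋙ F) (hF N hN)),
      ∀ σ : Aut c, e.hom ≫ @colimMap _ _ _ _ _ _ (hF N hN) (hF N hN) (Functor.whiskerRight (θ σ).hom F) =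
        colimMap (Functor.whiskerRight σ.hom F) ≫ e.hom := by
  obtain ⟨N, hN, hNb, ⟨ι⟩⟩ := exists_iso_galoisSystem hG c hgal hcof
  haveI := hF N hN
  exact ⟨N, hN, hNb, ι.conjAut, HasColimit.isoOfNatIso (Functor.isoWhiskerRight ι F),
    fun σ => colimit_isoOfNatIso_conjAut F ι σ⟩

end Colimits

end BaseGaloisSystem

end Literature.AlgebraicGeometry.Frobenioids

end
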